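import Summits.QuantumFields.GaugeBoot.DiagonalRPTorusClosedHalfNegativeThreeUniform
import Summits.QuantumFields.GaugeBoot.DiagonalRPTorusNegativeHighDimUniform
import Summits.QuantumFields.GaugeBoot.ClassBStrongCoupling
import HarnessLib

/-!
# Diagonal RP at strong coupling: every torus fails, every torus limit point succeeds (gauge-boot, L3 supplement)

HONEST FRAMING (cell `pub-gaugeboot`, page 1 of every file): the venture produces certified bounds
on lattice expectations at stated coupling, gauge group, dimension and torus size; NOT a mass gap,
NOT a continuum limit, NOT a string tension; NOT Yang–Mills-summit-bearing (barriers
`FixedCouplingUltralocality`, `PerturbativeInvisibility`). This module is a STRONG-COUPLING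
statement about lattice states, for citation; nothing is claimed at the couplings of the cell's
certificates.

## Content

Two results already in the tree, stated side by side at one coupling range, for the record of the
Class-B question (R9: `TorusLimitPointsDiagonalRP`):

* the UNIFORM-in-`L` negatives of gens 45 and 47 — for `SU(N)`, `N ≥ 2`, there is one
  `β₀(d, N) > 0` such that for every `L ≥ 3` and all `0 < β ≤ β₀` the Wilson theory on the cubic
  torus `(ℤ/L)^d` violates diagonal reflection positivity across `x₀ = x₁` (closed half for odd
  `L`, inner half for even `L`): `DiagRPHex.diagonalRP_fails_three_uniform_suN` (`d = 3`),
  `DiagRPUnif.diagonalRP_fails_suN_uniform` (`d ≥ 4`);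
* the strong-coupling positive of gen 2 — `thermodynamicLimitIsClassB_SU_strongCoupling`: for
  `0 ≤ β_tH < 1/(16(d-1))` (bare coupling `N β_tH`) every infinite-volume limit point of the torus
  states is a Class-B state, in particular diagonal-RP in every plane (DLR uniqueness,
  Shen–Zhu–Zhu as proved in the tree).

★ **`tori_fail_limit_holds_diagRP_three_suN`** (`d = 3`) and
★ **`tori_fail_limit_holds_diagRP_highDim_suN`** (`d ≥ 4`): there is `β₁ = β₁(d, N) > 0` such that
for every bare coupling `0 < β ≤ β₁` (a) NO torus `(ℤ/L)^d`, `L ≥ 3`, is diagonal-RP across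
`x₀ = x₁`, YET (b) EVERY infinite-volume limit point of these torus states at the same coupling IS
reflection positive in every diagonal hyperplane `x_i = x_j`. So at small coupling the diagonal-RP
obstruction on the tori (`DiagonalRPTorusNegative*`) is a pure finite-volume effect that disappears
in the limit — while (b) is unreachable by inheritance from the tori themselves (the point of the
"no eventual transfer" corollaries `DiagonalRPTorusHighDimNoTransfer`, `…ThreeNoTransfer`).
Nothing is decided outside the uniqueness window.
-/

noncomputable section

open MeasureTheory
open scoped ComplexConjugate ComplexOrder
open Literature.MathematicalPhysics.QuantumLattice

namespace Summit.QuantumFields.GaugeBoot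

variable {N : ℕ}

/-- Bare couplings `0 < β ≤ N/(32(d-1))` lie in the Shen–Zhu–Zhu window: `β = N · (β/N)` with
`0 ≤ β/N < 1/(16(d-1))` (`d ≥ 2`, `N ≥ 2`). [folklore] -/
theorem exists_tHooft_of_le_window {d : ℕ} (hd : 2 ≤ d) (hN : 2 ≤ N) {β : ℝ} (hβ : 0 < β)
    (hβ1 : β ≤ N / (32 * ((d : ℝ) - 1))) :
    0 ≤ β / N ∧ β / N < 1 / (16 * ((d : ℝ) - 1)) ∧ (N : ℝ) * (β / N) = β := by
  have hd' : (2 : ℝ) ≤ d := by exact_mod_cast hd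
  have hNr : (2 : ℝ) ≤ N := by exact_mod_cast hN
  have hN0 : (0 : ℝ) < N := by linarith
  have hD : (0 : ℝ) < 32 * ((d : ℝ) - 1) := by linarith
  rw [le_div_iff₀ hD] at hβ1
  refine ⟨div_nonneg hβ.le hN0.le, ?_, mul_div_cancel₀ β hN0.ne'⟩
  rw [div_lt_div_iff₀ hN0 (by linarith), one_mul]
  nlinarith

/-- ★ **THE CONTRAST IN `d = 3` (`SU(N)`, `N ≥ 2`).** There is `β₁ = β₁(N) > 0` such that for every
bare coupling `0 < β ≤ β₁`: (a) on EVERY cubic three-torus `(ℤ/L)^3`, `L ≥ 3`, diagonal reflection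
positivity across `x₀ = x₁` FAILS (closed half for odd `L`, inner half for even `L`; one window for
all `L`, gen 47), YET (b) EVERY infinite-volume limit point of the torus states at coupling `β` IS
reflection positive in every diagonal hyperplane `x_i = x_j` (it is the unique DLR state, a Class-B
state). [folklore] -/
theorem tori_fail_limit_holds_diagRP_three_suN (hN : 2 ≤ N) :
    ∃ β₁ : ℝ, 0 < β₁ ∧ ∀ β : ℝ, 0 < β → β ≤ β₁ →
      (∀ (L : ℕ) [NeZero L], 3 ≤ L →
        (Odd L → ¬ DiagonalReflectionPositive (d := 3) (L := L) (fundamentalRep (Fin N)) β 0 1) ∧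
          (Even L → ¬ InnerDiagonalRP (d := 3) (L := L) (fundamentalRep (Fin N)) β 0 1)) ∧
      TorusLimitPointsDiagonalRP 3 (fundamentalRep (Fin N)) β := by
  have hNr : (2 : ℝ) ≤ N := by exact_mod_cast hN
  have hN0 : (0 : ℝ) < N := by linarith
  obtain ⟨β₀, hβ₀, htor⟩ := DiagRPHex.diagonalRP_fails_three_uniform_suN hN
  refine ⟨min β₀ (N / 64), lt_min hβ₀ (by positivity),
    fun β hβ hβ1 => ⟨fun L _ hL => htor L hL β hβ (hβ1.trans (min_le_left _ _)), ?_⟩⟩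
  have hβN : β ≤ N / (32 * (((3 : ℕ) : ℝ) - 1)) := by
    have h := hβ1.trans (min_le_right _ _); norm_num; exact h
  obtain ⟨hγ0, hγ, hNγ⟩ := exists_tHooft_of_le_window (d := 3) (by norm_num) hN hβ hβN
  have h := thermodynamicLimitIsClassB_SU_strongCoupling (d := 3) (N := N) (by norm_num) hN hγ0 hγ
  rw [hNγ] at h
  exact torusLimitPointsDiagonalRP_of_thermodynamicLimitIsClassB (fundamentalRep (Fin N)) h

/-- ★ **THE CONTRAST IN `d ≥ 4` (`SU(N)`, `N ≥ 2`).** There is `β₁ = β₁(d, N) > 0` such that for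
every bare coupling `0 < β ≤ β₁`: (a) on EVERY torus `(ℤ/L)^d`, `L ≥ 3`, diagonal reflection
positivity across `x₀ = x₁` FAILS (gen 45's uniform window), YET (b) EVERY infinite-volume limit
point of the torus states at coupling `β` is reflection positive in every diagonal hyperplane.
[folklore] -/
theorem tori_fail_limit_holds_diagRP_highDim_suN {d : ℕ} (hd : 4 ≤ d) (hN : 2 ≤ N) :
    ∃ β₁ : ℝ, 0 < β₁ ∧ ∀ β : ℝ, 0 < β → β ≤ β₁ →
      (∀ (L : ℕ) [NeZero L], 3 ≤ L →
        (Odd L → ¬ DiagonalReflectionPositive (d := d) (L := L) (fundamentalRep (Fin N)) β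
            ⟨0, by omega⟩ ⟨1, by omega⟩) ∧
          (Even L → ¬ InnerDiagonalRP (d := d) (L := L) (fundamentalRep (Fin N)) β
            ⟨0, by omega⟩ ⟨1, by omega⟩)) ∧
      TorusLimitPointsDiagonalRP d (fundamentalRep (Fin N)) β := by
  have hd2 : 2 ≤ d := by omega
  have hd' : (4 : ℝ) ≤ d := by exact_mod_cast hd
  have hNr : (2 : ℝ) ≤ N := by exact_mod_cast hN
  have hN0 : (0 : ℝ) < N := by linarith
  have hD : (0 : ℝ) < 32 * ((d : ℝ) - 1) := by linarith
  obtain ⟨β₀, hβ₀, htor⟩ := DiagRPUnif.diagonalRP_fails_suN_uniform hd hN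
  refine ⟨min β₀ (N / (32 * ((d : ℝ) - 1))), lt_min hβ₀ (div_pos hN0 hD),
    fun β hβ hβ1 => ⟨fun L _ hL => htor L hL β hβ (hβ1.trans (min_le_left _ _)), ?_⟩⟩
  obtain ⟨hγ0, hγ, hNγ⟩ := exists_tHooft_of_le_window hd2 hN hβ (hβ1.trans (min_le_right _ _))
  have h := thermodynamicLimitIsClassB_SU_strongCoupling (d := d) (N := N) hd2 hN hγ0 hγ
  rw [hNγ] at h
  exact torusLimitPointsDiagonalRP_of_thermodynamicLimitIsClassB (fundamentalRep (Fin N)) h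

end Summit.QuantumFields.GaugeBoot

end
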